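import Mathlib
import Summits.CriticalPhenomena.CardyFormulaZ2.Theorems.CardySelfRefinementGradientComparabilityOfKernels
import Summits.CriticalPhenomena.CardyFormulaZ2.Theorems.CardySelfRefinementGradientComparabilityLevelCurves
import Summits.CriticalPhenomena.CardyFormulaZ2.Theorems.CardySelfRefinementGradientComparabilityStubLevelSetTransport
import HarnessLib

/-!
# Crux `GradientComparability` (stmt-CriticalPhenomena-10269), line `monotone-product-coordinates`:
# the two charts of the composition (`monotoneLine_charts`)

Route `CardySelfRefinement`, sub-problem `CriticalPhenomena/CardyFormulaZ2`; vocabulary (`P`, `Dρ`,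
`Dc`, `PathOK`, …) from `CardySelfRefinementDefs`.  Importable form of §5a–§5c of the line skeleton
`Cruxes/GradientComparability/Lines/monotone_product_coordinates.lean` (helper of the registered
composition `GradientComparability_of_monotoneLine`, file `…GradientComparabilityOfMonotoneLine`).

* `MonotoneLine.bulkChart`: for every depth `δ`, `G = |∂ρP| + |∂cP|` is comparable between bulk path
  points (`ρ ≤ 1 − δ`): slope bound ⨉ level-set comparability (to a same-level point of the slice
  `ρ = 0`, which exists by the IVT and the boundary values) ⨉ Kesten window on the independent slice.
* `MonotoneLine.cornerChart`: for some depth `δ ≤ ¼`, the same near the corner (`ρ ≥ 1 − 2δ`): corner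
  slope bound ⨉ level-set comparability (to a same-level point of `{c = 0} ∪ {ρ = 1}`) ⨉ corner patch.
* `monotoneLine_charts` (registered): both charts, with one constant and one mesh threshold, from the
  four inputs of the line — the slope bounds (conclusion of `stub_slopeBounds`), the level-set
  comparability (conclusion of the landed `stub_levelSetTransport`), the corner patch
  (`stub_cornerPatch`) and the window on the slice `ρ = 0` (`stub_windowAtRhoZero`), inlined verbatim.
-/

noncomputable section

namespace Summit.CriticalPhenomena.CardyFormulaZ2.Theorems.CardySelfRefinement

open scoped Topology
open Filter Set MeasureTheory
open Literature.Probability.LatticeModels Literature.Probability.Percolation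
open Literature.Probability.Percolation.QuadCrossing
open Summit.CriticalPhenomena.CardyFormulaZ2.Theses.CardySelfRefinement

namespace MonotoneLine

/-! ## Elementary glue lemmas
(adapted from §5a of `Cruxes/GradientComparability/Lines/monotone_product_coordinates.lean`) -/

/-- Upgrade a comparison constant to one `≥ 1` (only used with a nonnegative right-hand side). -/
theorem le_max_one_mul {a b Λ : ℝ} (h : a ≤ Λ * b) (hb : 0 ≤ b) : a ≤ max Λ 1 * b :=
  h.trans (mul_le_mul_of_nonneg_right (le_max_left _ _) hb)

/-- Shrinking a mesh threshold. -/
theorem Ioo_of_le {η a b : ℝ} (h : η ∈ Set.Ioo 0 a) (hab : a ≤ b) : η ∈ Set.Ioo 0 b :=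
  ⟨h.1, lt_of_lt_of_le h.2 hab⟩

/-- Splitting a sixfold mesh threshold. -/
theorem Ioo_min₆ {η a b c d e f : ℝ} (h : η ∈ Set.Ioo 0 (min (min a b) (min (min c d) (min e f)))) :
    η ∈ Set.Ioo 0 a ∧ η ∈ Set.Ioo 0 b ∧ η ∈ Set.Ioo 0 c ∧ η ∈ Set.Ioo 0 d ∧ η ∈ Set.Ioo 0 e ∧
      η ∈ Set.Ioo 0 f := by
  simp only [Set.mem_Ioo, lt_min_iff] at h
  obtain ⟨h0, ⟨ha, hb⟩, ⟨hc, hd⟩, he, hf⟩ := h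
  exact ⟨⟨h0, ha⟩, ⟨h0, hb⟩, ⟨h0, hc⟩, ⟨h0, hd⟩, ⟨h0, he⟩, ⟨h0, hf⟩⟩

/-- `c ↦ P_η(ρ, c)` is continuous on `[0,1]` (`P` agrees with a `C¹` function on the square). -/
theorem continuousOn_P_c (k m : ℕ) (F : Fin m → Quad (Set.univ : Set ℂ)) {η : ℝ} (hη : η ≠ 0)
    {ρ : ℝ} (hρ : ρ ∈ Set.Icc (0 : ℝ) 1) :
    ContinuousOn (fun c => P k m F η ρ c) (Set.Icc 0 1) := by
  obtain ⟨Φ, hΦ, hPΦ⟩ := exists_contDiff_eq_P k m F hη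
  have hc : Continuous fun c : ℝ => Φ (ρ, c) :=
    hΦ.continuous.comp (continuous_const.prodMk continuous_id)
  exact hc.continuousOn.congr fun c hc' => hPΦ ρ hρ c hc'

/-- `ρ ↦ P_η(ρ, c)` is continuous on `[0,1]`. -/
theorem continuousOn_P_ρ (k m : ℕ) (F : Fin m → Quad (Set.univ : Set ℂ)) {η : ℝ} (hη : η ≠ 0)
    {c : ℝ} (hc : c ∈ Set.Icc (0 : ℝ) 1) :
    ContinuousOn (fun ρ => P k m F η ρ c) (Set.Icc 0 1) := by
  obtain ⟨Φ, hΦ, hPΦ⟩ := exists_contDiff_eq_P k m F hη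
  have hc' : Continuous fun ρ : ℝ => Φ (ρ, c) :=
    hΦ.continuous.comp (continuous_id.prodMk continuous_const)
  exact hc'.continuousOn.congr fun ρ hρ => hPΦ ρ hρ c hc

/-- A same-level point on the slice `ρ = 0` (intermediate value theorem in `c`). -/
theorem exists_sameLevel_zero (k m : ℕ) (F : Fin m → Quad (Set.univ : Set ℂ)) {η : ℝ} (hη : η ≠ 0)
    {v : ℝ} (h0 : P k m F η 0 0 ≤ v) (h1 : v ≤ P k m F η 0 1) :
    ∃ c ∈ Set.Icc (0 : ℝ) 1, P k m F η 0 c = v :=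
  intermediate_value_Icc zero_le_one (continuousOn_P_c k m F hη (ρ := 0) ⟨le_rfl, zero_le_one⟩)
    ⟨h0, h1⟩

/-- A same-level point on the two slices through the corner with `ρ ≥ 1 − 2δ` (IVT along
`ρ ↦ (ρ,0)` on `[1−2δ,1]` or along `c ↦ (1,c)` on `[0,1]`). -/
theorem exists_sameLevel_corner (k m : ℕ) (F : Fin m → Quad (Set.univ : Set ℂ)) {η : ℝ} (hη : η ≠ 0)
    {δ : ℝ} (hδ : 0 < δ) (hδ' : δ ≤ 1 / 4) {v : ℝ} (hlo : P k m F η (1 - 2 * δ) 0 ≤ v)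
    (hhi : v ≤ P k m F η 1 1) :
    ∃ q ∈ Set.Icc (0 : ℝ) 1 ×ˢ Set.Icc (0 : ℝ) 1, (q.1 = 1 ∨ q.2 = 0) ∧ 1 - 2 * δ ≤ q.1 ∧
      P k m F η q.1 q.2 = v := by
  by_cases hv : v ≤ P k m F η 1 0
  · -- along the bottom slice `c = 0`
    have hsub : Set.Icc (1 - 2 * δ) 1 ⊆ Set.Icc (0 : ℝ) 1 := Set.Icc_subset_Icc (by linarith) le_rfl
    have hcont : ContinuousOn (fun ρ => P k m F η ρ 0) (Set.Icc (1 - 2 * δ) 1) :=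
      (continuousOn_P_ρ k m F hη (c := 0) ⟨le_rfl, zero_le_one⟩).mono hsub
    obtain ⟨ρ, hρ, hρv⟩ := intermediate_value_Icc (by linarith) hcont ⟨hlo, hv⟩
    exact ⟨(ρ, 0), ⟨hsub hρ, ⟨le_rfl, zero_le_one⟩⟩, Or.inr rfl, hρ.1, hρv⟩
  · -- along the right slice `ρ = 1`
    rw [not_le] at hv
    have hcont := continuousOn_P_c k m F hη (ρ := 1) ⟨zero_le_one, le_rfl⟩
    obtain ⟨c, hc, hcv⟩ := intermediate_value_Icc zero_le_one hcont ⟨hv.le, hhi⟩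
    exact ⟨(1, c), ⟨⟨zero_le_one, le_rfl⟩, hc⟩, Or.inl rfl, by linarith, hcv⟩

/-- Uniform levels along the path: `0 < VLO ≤ P_η(γ s) ≤ VHI < 1` with `VLO < VHI`, small mesh. -/
theorem exists_levels {k : ℕ} (hk : k = 2 ∨ k = 3) {γ : unitInterval → ℝ × ℝ} (hγ : PathOK k γ)
    {m : ℕ} (F : Fin m → Quad (Set.univ : Set ℂ)) (hm : 0 < m) :
    ∃ VLO VHI η₀ : ℝ, 0 < VLO ∧ VLO < VHI ∧ VHI < 1 ∧ 0 < η₀ ∧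
      ∀ η ∈ Set.Ioo 0 η₀, ∀ s : unitInterval, P k m F η (γ s).1 (γ s).2 ∈ Set.Icc VLO VHI := by
  obtain ⟨v₁, η₅, hv₁, hη₅, hlo⟩ := stub_pathPoint_lower k hk γ hγ m F hm
  obtain ⟨v₂, η₆, hv₂, hη₆, hhi⟩ := stub_pathPoint_upper k hk γ hγ m F hm
  refine ⟨min v₁ (1 / 4), max v₂ (3 / 4), min η₅ η₆, lt_min hv₁ (by norm_num), ?_,
    max_lt hv₂ (by norm_num), lt_min hη₅ hη₆, fun η hη s => ⟨?_, ?_⟩⟩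
  · calc min v₁ (1 / 4) ≤ 1 / 4 := min_le_right _ _
      _ < 3 / 4 := by norm_num
      _ ≤ max v₂ (3 / 4) := le_max_right _ _
  · exact (min_le_left _ _).trans (hlo η (Ioo_of_le hη (min_le_left _ _)) s)
  · exact (hhi η (Ioo_of_le hη (min_le_right _ _)) s).trans (le_max_left _ _)

/-! ## The two charts
(adapted from §5b–§5c of `Cruxes/GradientComparability/Lines/monotone_product_coordinates.lean`; the
inputs are stated for fixed `k, γ, m, F`) -/

/-- **Bulk chart.**  For every depth `δ`, the gradient sizes at two bulk path points (`ρ ≤ 1 − δ`) are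
comparable mesh-uniformly: `G(γ s) ≍ ∂cP(γ s)` (bulk slope bound `hS`) `≍ ∂cP(0, c₀)` (same level,
transported by the bulk level-set comparability `hT` to the slice `ρ = 0`; `c₀` exists by the IVT and
the boundary values) `≍ ∂cP(0, c₀′)` (Kesten window `hZ` of the independent slice)
`≍ ∂cP(γ s′) ≍ G(γ s′)`. -/
theorem bulkChart {k : ℕ} (hk : k = 2 ∨ k = 3) {γ : unitInterval → ℝ × ℝ} (hγ : PathOK k γ)
    {m : ℕ} (F : Fin m → Quad (Set.univ : Set ℂ)) (hm : 0 < m) {δ : ℝ} (hδ : 0 < δ) (hδ' : δ ≤ 1 / 2)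
    {C ηS : ℝ} (hηS : 0 < ηS) (hS : ∀ η ∈ Set.Ioo 0 ηS, ∀ s : unitInterval,
      (γ s).1 ≤ 1 - δ → |Dρ k m F η (γ s)| ≤ C * Dc k m F η (γ s))
    (hT : ∀ vlo vhi : ℝ, 0 < vlo → vlo < vhi → vhi < 1 → ∃ Λ η₁ : ℝ, 0 < η₁ ∧ ∀ η ∈ Set.Ioo 0 η₁,
      ∀ ρ₀ ∈ Set.Icc (0 : ℝ) (1 - δ), ∀ c₀ ∈ Set.Icc (0 : ℝ) 1,
      ∀ ρ₁ ∈ Set.Icc (0 : ℝ) (1 - δ), ∀ c₁ ∈ Set.Icc (0 : ℝ) 1,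
        P k m F η ρ₀ c₀ ∈ Set.Icc vlo vhi → P k m F η ρ₁ c₁ = P k m F η ρ₀ c₀ →
          Dc k m F η (ρ₁, c₁) ≤ Λ * Dc k m F η (ρ₀, c₀))
    (hZ : ∀ vlo vhi : ℝ, 0 < vlo → vlo < vhi → vhi < 1 → ∃ Λ η₁ : ℝ, 0 < η₁ ∧ ∀ η ∈ Set.Ioo 0 η₁,
      ∀ c ∈ Set.Icc (0 : ℝ) 1, ∀ c' ∈ Set.Icc (0 : ℝ) 1,
        P k m F η 0 c ∈ Set.Icc vlo vhi → P k m F η 0 c' ∈ Set.Icc vlo vhi →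
          Dc k m F η (0, c) ≤ Λ * Dc k m F η (0, c')) :
    ∃ Λ₁ η₁ : ℝ, 0 < η₁ ∧ ∀ s s' : unitInterval, (γ s).1 ≤ 1 - δ → (γ s').1 ≤ 1 - δ →
      ∀ η ∈ Set.Ioo 0 η₁,
        |Dρ k m F η (γ s)| + |Dc k m F η (γ s)| ≤ Λ₁ * (|Dρ k m F η (γ s')| + |Dc k m F η (γ s')|) := by
  obtain ⟨VLO, VHI, η₀, hVLO, hVV, hVHI, hη₀, hlev⟩ := exists_levels hk hγ F hm
  obtain ⟨ΛT, ηT, hηT, hT⟩ := hT VLO VHI hVLO hVV hVHI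
  obtain ⟨Λ0, ηZ, hηZ, hZ⟩ := hZ VLO VHI hVLO hVV hVHI
  obtain ⟨ηB, hηB, hBV⟩ := stub_boundaryValues k hk γ hγ m F hm δ hδ hδ' VLO VHI hVLO hVV hVHI
  obtain ⟨ηL, hηL, hLC⟩ := levelCurves_unconditional k hk γ hγ m F hm δ hδ hδ' VLO VHI hVLO hVV hVHI
  set C' := max C 0 with hC'
  set LT := max ΛT 1 with hLT
  set L0 := max Λ0 1 with hL0
  refine ⟨(1 + C') * LT * L0 * LT, min (min η₀ ηS) (min (min ηT ηZ) (min ηB ηL)),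
    lt_min (lt_min hη₀ hηS) (lt_min (lt_min hηT hηZ) (lt_min hηB hηL)), ?_⟩
  intro s s' hs hs' η hη
  obtain ⟨hη0', hηS', hηT', hηZ', hηB', hηL'⟩ := Ioo_min₆ hη
  have hηne : η ≠ 0 := hη.1.ne'
  -- positivity of `∂cP` on the band
  obtain ⟨-, -, -, -, -, hPOS, -⟩ := hLC η hηL'
  -- the two path points
  have hsq := hγ.2.2.2.1 s
  have hsq' := hγ.2.2.2.1 s'
  have hρI : (γ s).1 ∈ Set.Icc (0 : ℝ) (1 - δ) := ⟨hsq.1.1, hs⟩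
  have hρI' : (γ s').1 ∈ Set.Icc (0 : ℝ) (1 - δ) := ⟨hsq'.1.1, hs'⟩
  have hv := hlev η hη0' s
  have hv' := hlev η hη0' s'
  -- same-level points on the slice `ρ = 0`
  have h0I : (0 : ℝ) ∈ Set.Icc (0 : ℝ) (1 - δ) := ⟨le_rfl, by linarith⟩
  obtain ⟨hB0, hB1⟩ := hBV η hηB' 0 h0I
  obtain ⟨c₀, hc₀, hPc₀⟩ := exists_sameLevel_zero k m F hηne (v := P k m F η (γ s).1 (γ s).2)
    (by linarith [hv.1]) (by linarith [hv.2])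
  obtain ⟨c₀', hc₀', hPc₀'⟩ := exists_sameLevel_zero k m F hηne (v := P k m F η (γ s').1 (γ s').2)
    (by linarith [hv'.1]) (by linarith [hv'.2])
  have hv₀ : P k m F η 0 c₀ ∈ Set.Icc VLO VHI := by rw [hPc₀]; exact hv
  have hv₀' : P k m F η 0 c₀' ∈ Set.Icc VLO VHI := by rw [hPc₀']; exact hv'
  -- positivity
  have hpos_s : 0 < Dc k m F η ((γ s).1, (γ s).2) := hPOS _ hρI _ hsq.2 hv
  have hpos_s' : 0 < Dc k m F η ((γ s').1, (γ s').2) := hPOS _ hρI' _ hsq'.2 hv'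
  have hpos₀ : 0 < Dc k m F η (0, c₀) := hPOS 0 h0I c₀ hc₀ hv₀
  have hpos₀' : 0 < Dc k m F η (0, c₀') := hPOS 0 h0I c₀' hc₀' hv₀'
  -- the four comparisons
  have e_s : Dc k m F η (γ s) = Dc k m F η ((γ s).1, (γ s).2) := rfl
  have e_s' : Dc k m F η (γ s') = Dc k m F η ((γ s').1, (γ s').2) := rfl
  have h1 : |Dρ k m F η (γ s)| + |Dc k m F η (γ s)| ≤ (1 + C') * Dc k m F η ((γ s).1, (γ s).2) := by
    have hsb := hS η hηS' s hs
    rw [e_s] at hsb ⊢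
    rw [abs_of_pos hpos_s]
    have : |Dρ k m F η (γ s)| ≤ C' * Dc k m F η ((γ s).1, (γ s).2) :=
      hsb.trans (mul_le_mul_of_nonneg_right (le_max_left _ _) hpos_s.le)
    linarith
  have h2 : Dc k m F η ((γ s).1, (γ s).2) ≤ LT * Dc k m F η (0, c₀) :=
    le_max_one_mul (hT η hηT' 0 h0I c₀ hc₀ (γ s).1 hρI (γ s).2 hsq.2 hv₀ hPc₀.symm) hpos₀.le
  have h3 : Dc k m F η (0, c₀) ≤ L0 * Dc k m F η (0, c₀') :=
    le_max_one_mul (hZ η hηZ' c₀ hc₀ c₀' hc₀' hv₀ hv₀') hpos₀'.le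
  have h4 : Dc k m F η (0, c₀') ≤ LT * Dc k m F η ((γ s').1, (γ s').2) :=
    le_max_one_mul (hT η hηT' (γ s').1 hρI' (γ s').2 hsq'.2 0 h0I c₀' hc₀' hv' hPc₀') hpos_s'.le
  have h5 : Dc k m F η ((γ s').1, (γ s').2) ≤ |Dρ k m F η (γ s')| + |Dc k m F η (γ s')| := by
    rw [← e_s']
    exact (le_abs_self _).trans (le_add_of_nonneg_left (abs_nonneg _))
  have hC'0 : 0 ≤ C' := le_max_right _ _
  have hLT0 : 0 ≤ LT := zero_le_one.trans (le_max_right _ _)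
  have hL00 : 0 ≤ L0 := zero_le_one.trans (le_max_right _ _)
  calc |Dρ k m F η (γ s)| + |Dc k m F η (γ s)|
      ≤ (1 + C') * Dc k m F η ((γ s).1, (γ s).2) := h1
    _ ≤ (1 + C') * (LT * Dc k m F η (0, c₀)) := by gcongr
    _ ≤ (1 + C') * (LT * (L0 * Dc k m F η (0, c₀'))) := by gcongr
    _ ≤ (1 + C') * (LT * (L0 * (LT * Dc k m F η ((γ s').1, (γ s').2)))) := by gcongr
    _ ≤ (1 + C') * (LT * (L0 * (LT * (|Dρ k m F η (γ s')| + |Dc k m F η (γ s')|)))) := by gcongr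
    _ = (1 + C') * LT * L0 * LT * (|Dρ k m F η (γ s')| + |Dc k m F η (γ s')|) := by ring

/-- **Corner chart.**  For some depth `δ ∈ (0,¼]`, the gradient sizes at two corner path points
(`ρ ≥ 1 − 2δ`) are comparable mesh-uniformly: `G(γ s) ≍ |∂ρP(γ s)|` (corner slope bound `hS` of
depth `δ₁`) `≍ |∂ρP(e)|` (same level, `e` on `{c = 0} ∪ {ρ = 1}` by the IVT, the boundary values
and `P_one_eq_one_of_mem_Ioo`; corner level-set comparability `hT` of depth `δ₂`) `≍ |∂ρP(e′)|`
(patch `hPt` at the independent corner) `≍ |∂ρP(γ s′)| ≍ G(γ s′)`; `δ = min δ₁ δ₂`. -/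
theorem cornerChart {k : ℕ} (hk : k = 2 ∨ k = 3) {γ : unitInterval → ℝ × ℝ} (hγ : PathOK k γ)
    {m : ℕ} (F : Fin m → Quad (Set.univ : Set ℂ)) (hm : 0 < m) {δ₁ : ℝ} (hδ₁ : 0 < δ₁)
    (hδ₁' : δ₁ ≤ 1 / 4)
    (hS : ∀ vlo vhi : ℝ, 0 < vlo → vlo < vhi → vhi < 1 → ∃ C η₁ : ℝ, 0 < η₁ ∧ ∀ η ∈ Set.Ioo 0 η₁,
      ∀ ρ ∈ Set.Icc (1 - 2 * δ₁) 1, ∀ c ∈ Set.Icc (0 : ℝ) 1, P k m F η ρ c ∈ Set.Icc vlo vhi →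
        |Dc k m F η (ρ, c)| ≤ C * |Dρ k m F η (ρ, c)|)
    {δ₂ : ℝ} (hδ₂ : 0 < δ₂)
    (hT : ∀ vlo vhi : ℝ, 0 < vlo → vlo < vhi → vhi < 1 → ∃ Λ η₁ : ℝ, 0 < η₁ ∧ ∀ η ∈ Set.Ioo 0 η₁,
      ∀ ρ₀ ∈ Set.Icc (1 - 2 * δ₂) 1, ∀ c₀ ∈ Set.Icc (0 : ℝ) 1,
      ∀ ρ₁ ∈ Set.Icc (1 - 2 * δ₂) 1, ∀ c₁ ∈ Set.Icc (0 : ℝ) 1,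
        P k m F η ρ₀ c₀ ∈ Set.Icc vlo vhi → P k m F η ρ₁ c₁ = P k m F η ρ₀ c₀ →
          |Dρ k m F η (ρ₁, c₁)| ≤ Λ * |Dρ k m F η (ρ₀, c₀)|)
    (hPt : ∀ vlo vhi : ℝ, 0 < vlo → vlo < vhi → vhi < 1 → ∃ Λ η₁ : ℝ, 0 < η₁ ∧ ∀ η ∈ Set.Ioo 0 η₁,
      ∀ q ∈ Set.Icc (0 : ℝ) 1 ×ˢ Set.Icc (0 : ℝ) 1, ∀ q' ∈ Set.Icc (0 : ℝ) 1 ×ˢ Set.Icc (0 : ℝ) 1,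
        (q.1 = 1 ∨ q.2 = 0) → (q'.1 = 1 ∨ q'.2 = 0) →
          P k m F η q.1 q.2 ∈ Set.Icc vlo vhi → P k m F η q'.1 q'.2 ∈ Set.Icc vlo vhi →
            |Dρ k m F η q| ≤ Λ * |Dρ k m F η q'|) :
    ∃ δ : ℝ, 0 < δ ∧ δ ≤ 1 / 2 ∧ ∃ Λ₂ η₂ : ℝ, 0 < η₂ ∧
      ∀ s s' : unitInterval, 1 - 2 * δ ≤ (γ s).1 → 1 - 2 * δ ≤ (γ s').1 → ∀ η ∈ Set.Ioo 0 η₂,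
        |Dρ k m F η (γ s)| + |Dc k m F η (γ s)| ≤ Λ₂ * (|Dρ k m F η (γ s')| + |Dc k m F η (γ s')|) := by
  obtain ⟨VLO, VHI, η₀, hVLO, hVV, hVHI, hη₀, hlev⟩ := exists_levels hk hγ F hm
  obtain ⟨C, ηS, hηS, hS⟩ := hS VLO VHI hVLO hVV hVHI
  obtain ⟨ΛT, ηT, hηT, hT⟩ := hT VLO VHI hVLO hVV hVHI
  obtain ⟨ΛP, ηP, hηP, hPt⟩ := hPt VLO VHI hVLO hVV hVHI
  set δ := min δ₁ δ₂ with hδdef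
  have hδ : 0 < δ := lt_min hδ₁ hδ₂
  have hδ4 : δ ≤ 1 / 4 := (min_le_left _ _).trans hδ₁'
  have hδle₁ : δ ≤ δ₁ := min_le_left _ _
  have hδle₂ : δ ≤ δ₂ := min_le_right _ _
  obtain ⟨ηB, hηB, hBV⟩ := stub_boundaryValues k hk γ hγ m F hm (2 * δ) (by positivity) (by linarith)
    VLO VHI hVLO hVV hVHI
  obtain ⟨η₇, hη₇, hP1⟩ := P_one_eq_one_of_mem_Ioo hk m F
  set C' := max C 0 with hC'
  set LT := max ΛT 1 with hLT
  set LP := max ΛP 1 with hLP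
  refine ⟨δ, hδ, by linarith, (1 + C') * LT * LP * LT, min (min η₀ ηS) (min (min ηT ηP) (min ηB η₇)),
    lt_min (lt_min hη₀ hηS) (lt_min (lt_min hηT hηP) (lt_min hηB hη₇)), ?_⟩
  intro s s' hs hs' η hη
  obtain ⟨hη0', hηS', hηT', hηP', hηB', hη7'⟩ := Ioo_min₆ hη
  have hηne : η ≠ 0 := hη.1.ne'
  -- the two path points
  have hsq := hγ.2.2.2.1 s
  have hsq' := hγ.2.2.2.1 s'
  have hρ₁ : (γ s).1 ∈ Set.Icc (1 - 2 * δ₁) 1 := ⟨by linarith, hsq.1.2⟩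
  have hρ₂ : (γ s).1 ∈ Set.Icc (1 - 2 * δ₂) 1 := ⟨by linarith, hsq.1.2⟩
  have hρ₂' : (γ s').1 ∈ Set.Icc (1 - 2 * δ₂) 1 := ⟨by linarith, hsq'.1.2⟩
  have hv := hlev η hη0' s
  have hv' := hlev η hη0' s'
  -- same-level points on the two slices through the corner
  have hB0 : P k m F η (1 - 2 * δ) 0 < VLO := (hBV η hηB' (1 - 2 * δ) ⟨by linarith, le_rfl⟩).1
  have hP11 : P k m F η 1 1 = 1 := hP1 η hη7' 1
  obtain ⟨e, he, heS, heρ, hPe⟩ := exists_sameLevel_corner k m F hηne hδ hδ4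
    (v := P k m F η (γ s).1 (γ s).2) (by linarith [hv.1]) (by rw [hP11]; linarith [hv.2])
  obtain ⟨e', he', heS', heρ', hPe'⟩ := exists_sameLevel_corner k m F hηne hδ hδ4
    (v := P k m F η (γ s').1 (γ s').2) (by linarith [hv'.1]) (by rw [hP11]; linarith [hv'.2])
  have hve : P k m F η e.1 e.2 ∈ Set.Icc VLO VHI := by rw [hPe]; exact hv
  have hve' : P k m F η e'.1 e'.2 ∈ Set.Icc VLO VHI := by rw [hPe']; exact hv'
  have heρ₂ : e.1 ∈ Set.Icc (1 - 2 * δ₂) 1 := ⟨by linarith, he.1.2⟩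
  have heρ₂' : e'.1 ∈ Set.Icc (1 - 2 * δ₂) 1 := ⟨by linarith, he'.1.2⟩
  -- the four comparisons
  have e_s : Dρ k m F η (γ s) = Dρ k m F η ((γ s).1, (γ s).2) := rfl
  have e_s' : Dρ k m F η (γ s') = Dρ k m F η ((γ s').1, (γ s').2) := rfl
  have ec_s : Dc k m F η (γ s) = Dc k m F η ((γ s).1, (γ s).2) := rfl
  have e_e : Dρ k m F η e = Dρ k m F η (e.1, e.2) := rfl
  have e_e' : Dρ k m F η e' = Dρ k m F η (e'.1, e'.2) := rfl
  have h1 : |Dρ k m F η (γ s)| + |Dc k m F η (γ s)| ≤ (1 + C') * |Dρ k m F η ((γ s).1, (γ s).2)| := by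
    have hsb := hS η hηS' (γ s).1 hρ₁ (γ s).2 hsq.2 hv
    rw [e_s, ec_s]
    have : |Dc k m F η ((γ s).1, (γ s).2)| ≤ C' * |Dρ k m F η ((γ s).1, (γ s).2)| :=
      hsb.trans (mul_le_mul_of_nonneg_right (le_max_left _ _) (abs_nonneg _))
    linarith
  have h2 : |Dρ k m F η ((γ s).1, (γ s).2)| ≤ LT * |Dρ k m F η (e.1, e.2)| :=
    le_max_one_mul (hT η hηT' e.1 heρ₂ e.2 he.2 (γ s).1 hρ₂ (γ s).2 hsq.2 hve hPe.symm) (abs_nonneg _)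
  have h3 : |Dρ k m F η (e.1, e.2)| ≤ LP * |Dρ k m F η (e'.1, e'.2)| := by
    rw [← e_e, ← e_e']
    exact le_max_one_mul (hPt η hηP' e he e' he' heS heS' hve hve') (abs_nonneg _)
  have h4 : |Dρ k m F η (e'.1, e'.2)| ≤ LT * |Dρ k m F η ((γ s').1, (γ s').2)| :=
    le_max_one_mul (hT η hηT' (γ s').1 hρ₂' (γ s').2 hsq'.2 e'.1 heρ₂' e'.2 he'.2 hv' hPe')
      (abs_nonneg _)
  have h5 : |Dρ k m F η ((γ s').1, (γ s').2)| ≤ |Dρ k m F η (γ s')| + |Dc k m F η (γ s')| := by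
    rw [← e_s']
    exact le_add_of_nonneg_right (abs_nonneg _)
  have hC'0 : 0 ≤ C' := le_max_right _ _
  have hLT0 : 0 ≤ LT := zero_le_one.trans (le_max_right _ _)
  have hLP0 : 0 ≤ LP := zero_le_one.trans (le_max_right _ _)
  calc |Dρ k m F η (γ s)| + |Dc k m F η (γ s)|
      ≤ (1 + C') * |Dρ k m F η ((γ s).1, (γ s).2)| := h1
    _ ≤ (1 + C') * (LT * |Dρ k m F η (e.1, e.2)|) := by gcongr
    _ ≤ (1 + C') * (LT * (LP * |Dρ k m F η (e'.1, e'.2)|)) := by gcongr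
    _ ≤ (1 + C') * (LT * (LP * (LT * |Dρ k m F η ((γ s').1, (γ s').2)|))) := by gcongr
    _ ≤ (1 + C') * (LT * (LP * (LT * (|Dρ k m F η (γ s')| + |Dc k m F η (γ s')|)))) := by gcongr
    _ = (1 + C') * LT * LP * LT * (|Dρ k m F η (γ s')| + |Dc k m F η (γ s')|) := by ring

end MonotoneLine

/-- **The two charts of the line `monotone-product-coordinates` (registered helper of the composition
`GradientComparability_of_monotoneLine`).**  From the four inputs of the line — the first-order slope
bounds (the conclusion of `stub_slopeBounds`), the level-set comparability (the conclusion of the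
landed `stub_levelSetTransport`), the Kesten patch at the independent corner (`stub_cornerPatch`) and
the Kesten window on the independent slice `ρ = 0` (`stub_windowAtRhoZero`), their signatures inlined
verbatim and in this order — for every admissible path and every nonempty quad family there are a
depth `δ ∈ (0,½]`, ONE constant `Λ` and ONE mesh threshold `η₀` such that the gradient size
`|∂ρP| + |∂cP|` is `Λ`-comparable between any two bulk path points (`ρ ≤ 1 − δ`, `MonotoneLine.bulkChart`)
and between any two corner path points (`ρ ≥ 1 − 2δ`, `MonotoneLine.cornerChart`), at every mesh
`η < η₀`. -/
theorem monotoneLine_charts :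
    (∀ k : ℕ, k = 2 ∨ k = 3 → ∀ γ : unitInterval → ℝ × ℝ, PathOK k γ →
      ∀ (m : ℕ) (F : Fin m → Quad (Set.univ : Set ℂ)), 0 < m →
        (∀ δ : ℝ, 0 < δ → δ ≤ 1 / 2 → ∃ C η₁ : ℝ, 0 < η₁ ∧ ∀ η ∈ Set.Ioo 0 η₁, ∀ s : unitInterval,
            (γ s).1 ≤ 1 - δ → |Dρ k m F η (γ s)| ≤ C * Dc k m F η (γ s)) ∧
        (∃ δ : ℝ, 0 < δ ∧ δ ≤ 1 / 4 ∧ ∀ vlo vhi : ℝ, 0 < vlo → vlo < vhi → vhi < 1 →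
            ∃ C η₁ : ℝ, 0 < η₁ ∧ ∀ η ∈ Set.Ioo 0 η₁, ∀ ρ ∈ Set.Icc (1 - 2 * δ) 1,
              ∀ c ∈ Set.Icc (0 : ℝ) 1, P k m F η ρ c ∈ Set.Icc vlo vhi →
                |Dc k m F η (ρ, c)| ≤ C * |Dρ k m F η (ρ, c)|)) →
    (∀ k : ℕ, k = 2 ∨ k = 3 → ∀ γ : unitInterval → ℝ × ℝ, PathOK k γ →
      ∀ (m : ℕ) (F : Fin m → Quad (Set.univ : Set ℂ)), 0 < m →
        (∀ δ : ℝ, 0 < δ → δ ≤ 1 / 2 → ∀ vlo vhi : ℝ, 0 < vlo → vlo < vhi → vhi < 1 →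
          ∃ Λ η₁ : ℝ, 0 < η₁ ∧ ∀ η ∈ Set.Ioo 0 η₁,
            ∀ ρ₀ ∈ Set.Icc (0 : ℝ) (1 - δ), ∀ c₀ ∈ Set.Icc (0 : ℝ) 1,
            ∀ ρ₁ ∈ Set.Icc (0 : ℝ) (1 - δ), ∀ c₁ ∈ Set.Icc (0 : ℝ) 1,
              P k m F η ρ₀ c₀ ∈ Set.Icc vlo vhi → P k m F η ρ₁ c₁ = P k m F η ρ₀ c₀ →
                Dc k m F η (ρ₁, c₁) ≤ Λ * Dc k m F η (ρ₀, c₀)) ∧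
        (∃ δ : ℝ, 0 < δ ∧ δ ≤ 1 / 4 ∧ ∀ vlo vhi : ℝ, 0 < vlo → vlo < vhi → vhi < 1 →
          ∃ Λ η₁ : ℝ, 0 < η₁ ∧ ∀ η ∈ Set.Ioo 0 η₁,
            ∀ ρ₀ ∈ Set.Icc (1 - 2 * δ) 1, ∀ c₀ ∈ Set.Icc (0 : ℝ) 1,
            ∀ ρ₁ ∈ Set.Icc (1 - 2 * δ) 1, ∀ c₁ ∈ Set.Icc (0 : ℝ) 1,
              P k m F η ρ₀ c₀ ∈ Set.Icc vlo vhi → P k m F η ρ₁ c₁ = P k m F η ρ₀ c₀ →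
                |Dρ k m F η (ρ₁, c₁)| ≤ Λ * |Dρ k m F η (ρ₀, c₀)|)) →
    (∀ k : ℕ, k = 2 ∨ k = 3 → ∀ (m : ℕ) (F : Fin m → Quad (Set.univ : Set ℂ)), 0 < m →
      ∀ vlo vhi : ℝ, 0 < vlo → vlo < vhi → vhi < 1 →
        ∃ Λ η₁ : ℝ, 0 < η₁ ∧ ∀ η ∈ Set.Ioo 0 η₁,
          ∀ q ∈ Set.Icc (0 : ℝ) 1 ×ˢ Set.Icc (0 : ℝ) 1, ∀ q' ∈ Set.Icc (0 : ℝ) 1 ×ˢ Set.Icc (0 : ℝ) 1,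
            (q.1 = 1 ∨ q.2 = 0) → (q'.1 = 1 ∨ q'.2 = 0) →
              P k m F η q.1 q.2 ∈ Set.Icc vlo vhi → P k m F η q'.1 q'.2 ∈ Set.Icc vlo vhi →
                |Dρ k m F η q| ≤ Λ * |Dρ k m F η q'|) →
    (∀ k : ℕ, k = 2 ∨ k = 3 → ∀ (m : ℕ) (F : Fin m → Quad (Set.univ : Set ℂ)), 0 < m →
      ∀ vlo vhi : ℝ, 0 < vlo → vlo < vhi → vhi < 1 →
        ∃ Λ η₁ : ℝ, 0 < η₁ ∧ ∀ η ∈ Set.Ioo 0 η₁, ∀ c ∈ Set.Icc (0 : ℝ) 1, ∀ c' ∈ Set.Icc (0 : ℝ) 1,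
          P k m F η 0 c ∈ Set.Icc vlo vhi → P k m F η 0 c' ∈ Set.Icc vlo vhi →
            Dc k m F η (0, c) ≤ Λ * Dc k m F η (0, c')) →
    ∀ k : ℕ, k = 2 ∨ k = 3 → ∀ γ : unitInterval → ℝ × ℝ, PathOK k γ →
      ∀ (m : ℕ) (F : Fin m → Quad (Set.univ : Set ℂ)), 0 < m →
        ∃ δ Λ η₀ : ℝ, 0 < δ ∧ δ ≤ 1 / 2 ∧ 0 < η₀ ∧ ∀ s s' : unitInterval, ∀ η ∈ Set.Ioo 0 η₀,
          ((γ s).1 ≤ 1 - δ → (γ s').1 ≤ 1 - δ →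
            |Dρ k m F η (γ s)| + |Dc k m F η (γ s)| ≤
              Λ * (|Dρ k m F η (γ s')| + |Dc k m F η (γ s')|)) ∧
          (1 - 2 * δ ≤ (γ s).1 → 1 - 2 * δ ≤ (γ s').1 →
            |Dρ k m F η (γ s)| + |Dc k m F η (γ s)| ≤
              Λ * (|Dρ k m F η (γ s')| + |Dc k m F η (γ s')|)) := by
  intro hSB hLSC hCP hK0 k hk γ hγ m F hm
  obtain ⟨δ₁, hδ₁, hδ₁', hS1⟩ := (hSB k hk γ hγ m F hm).2
  obtain ⟨δ₂, hδ₂, -, hT1⟩ := (hLSC k hk γ hγ m F hm).2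
  obtain ⟨δ, hδ, hδ', Λ₂, η₂, hη₂, hcorner⟩ :=
    MonotoneLine.cornerChart hk hγ F hm hδ₁ hδ₁' hS1 hδ₂ hT1 (hCP k hk m F hm)
  obtain ⟨C, ηS, hηS, hS⟩ := (hSB k hk γ hγ m F hm).1 δ hδ hδ'
  obtain ⟨Λ₁, η₁, hη₁, hbulk⟩ :=
    MonotoneLine.bulkChart hk hγ F hm hδ hδ' hηS hS ((hLSC k hk γ hγ m F hm).1 δ hδ hδ')
      (hK0 k hk m F hm)
  refine ⟨δ, max Λ₁ Λ₂, min η₁ η₂, hδ, hδ', lt_min hη₁ hη₂, fun s s' η hη =>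
    ⟨fun hs hs' => ?_, fun hs hs' => ?_⟩⟩
  · exact (hbulk s s' hs hs' η (MonotoneLine.Ioo_of_le hη (min_le_left _ _))).trans
      (mul_le_mul_of_nonneg_right (le_max_left _ _) (by positivity))
  · exact (hcorner s s' hs hs' η (MonotoneLine.Ioo_of_le hη (min_le_right _ _))).trans
      (mul_le_mul_of_nonneg_right (le_max_right _ _) (by positivity))

end Summit.CriticalPhenomena.CardyFormulaZ2.Theorems.CardySelfRefinement

end
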